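import Literature.AlgebraicGeometry.HodgeTheory.UnitaryCommutatorsIdentityComponent
import Literature.AlgebraicGeometry.HodgeTheory.StabilizerRestrictionHom
import Literature.AlgebraicGeometry.HodgeTheory.HermitianFormEigenspaceNondegenerate
import Literature.AlgebraicGeometry.HodgeTheory.CyclicReflectionNormalizedRoot
import Literature.AlgebraicGeometry.HodgeTheory.CyclicReflectionEigenspaceSpan
import Literature.AlgebraicGeometry.HodgeTheory.ComplexReflectionTwist
import Literature.AlgebraicGeometry.HodgeTheory.ComplexReflectionRootScaling
import Literature.AlgebraicGeometry.HodgeTheory.CyclicEigenspaceDimensions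
import Literature.AlgebraicGeometry.HodgeTheory.CyclicReflectionRational
import Literature.AlgebraicGeometry.HodgeTheory.GlZariskiClosurePolynomialMap
import Literature.AlgebraicGeometry.HodgeTheory.GlZariskiClosureGroup
import Literature.AlgebraicGeometry.HodgeTheory.ZariskiClosureBaseChange
import Literature.AlgebraicGeometry.HodgeTheory.CyclicEigenblockSection
import Literature.AlgebraicGeometry.HodgeTheory.GoursatKolchinRibetDischarge
import Literature.LinearAlgebra.Matrix.SpecialLinearEquivPerfect
import Summits.HodgeConjecture.HodgeConjecture.Theorems.CyclicUnitaryPowersLaneDKatz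
import HarnessLib

/-!
# Crux K1 `VeryGeneralDeckCommutatorsInHg` (route `CyclicUnitaryPowers`, stmt-HodgeConjecture-19544): lane A's brick B2
# `UnitaryReflectionDensity` — commutators of `τ`-unitary isometries lie in `(⁅Γ', Γ'⁆)^Zar(ℚ)` for EVERY
# finite-index `Γ' ≤ Γ` — PROVED from the lane-D machinery (Carlson–Toledo Thm 7.1 + Goursat–Kolchin–Ribet + `SL` perfect)

The registered line `unitary-reflection-zariski` (planner P3; lane A) closes K1 from the Carlson–Toledo facts, the
Cattani–Deligne–Kaplan cover, **CMSP Lemma–Definition 15.3.7 (i)** (`deligne_finiteIndex_monodromy_le_mumfordTateGroup`: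
a finite-index subgroup `Γ'` of the monodromy group lies in `MT`), the landed any-weight brick B1
(`mem_hodgeGroup_of_mem_glZariskiClosure_commutator`: `(⁅Γ', Γ'⁆)^Zar(ℚ) ⊆ Hg` for `Γ' ≤ MT`) and the algebraic brick
**B2** = `UnitaryReflectionDensity` (statement 3 of the line, signature registered as `stub_unitaryReflectionDensity`
in v1–v7): for every finite-index `Γ' ≤ Γ`, every commutator of two `τ`-commuting `B`-isometries lies in
`glZariskiClosure ⁅Γ', Γ'⁆`.  Lane D (prover-Ax g0 / prover-A g2, landed `CyclicUnitaryPowersLaneDGlue`) proved the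
weaker identity-component form D (conclusion `glIdentityComponent Γ`) and exited through André's Theorem 1.

This file proves **B2 itself** from the same three inputs as the lane-D glue — the Carlson–Toledo density fact CT71
(`carlsonToledo1999_unitaryReflection_zariskiDense`, cited) and the two DISCHARGED facts GKR'
(`Katz1990_goursatKolchinRibet_specialLinear'_holds`, p575350) and UD
(`specialLinear_subset_glIdentityComponent_of_unitary_commutators_holds`) — so that K1 closes through lane A's
composition WITHOUT André's theorem, on the shallower Deligne/CMSP 15.3.7 fact (shared with route B's crux 19716).
The upgrade D ⇒ B2 is pure algebra: lane D gives `⊕_i SL(E_i)(ℂ) ⊆ (H^Zar)°` for the block image `H` of `Γ ⊗ ℂ`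
(`CyclicUnitaryPowersLaneDKatz.blockDiag_mem_glIdentityComponent`), hence `⊆ (H'^Zar)` for the finite-index image
`H'` of `Γ' ⊗ ℂ`; commutators of closure points lie in the closure of the commutator group
(`commutator_mem_glZariskiClosure_commutator`, Borel I.2.4), and `⊕_i SL(E_i)(ℂ)` is PERFECT
(`Literature.LinearAlgebra.Matrix.pi_mem_of_det_eq_one_of_forall_commutator_mem`, Artin GA IV Thm 4.7), so
`⊕_i SL(E_i)(ℂ) ⊆ (⁅H', H'⁆)^Zar`; the eigenblock SECTION (`exists_cyclicEigenblockSection_pointwise`, prover-A g2)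
transports this to `(⁅Γ', Γ'⁆ ⊗ ℂ)^Zar ∋ c ⊗ ℂ`, and Zariski-closure membership descends to `ℚ`
(`mem_glZariskiClosure_of_baseChange`).  Main results: `unitaryReflectionDensity_of_facts : CT71 → GKR' → UD → B2`
(B2 verbatim) and `unitaryReflectionDensity_of_CT71 : CT71 → B2`.

## References
* [CarlsonToledo1999] J. A. Carlson, D. Toledo, *Discriminant complements and kernels of monodromy
  representations*, Duke Math. J. 97 (1999), §7 Theorem 7.1.
* [Katz1990ESDE] N. M. Katz, *Exponential Sums and Differential Equations*, Ann. of Math. Stud. 124 (1990), §1.8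
  Prop. 1.8.2.
* [Borel1991] A. Borel, *Linear Algebraic Groups*, 2nd ed., GTM 126, I.2.4 (commutators of closures).
* [Artin1988] E. Artin, *Geometric Algebra*, Chap. IV Thm 4.7 (`SL_n` perfect).
* [CarlsonMullerStachPeters2017] J. Carlson, S. Müller-Stach, C. Peters, *Period Mappings and Period Domains*,
  2nd ed., Lemma–Definition 15.3.7.
-/

noncomputable section

open Module Literature.AlgebraicGeometry.Motives Literature.AlgebraicGeometry.HodgeTheory
open scoped TensorProduct ComplexConjugate

-- `Summit.HodgeConjecture.HodgeConjecture.Theorems` is the mandated namespace (single-problem summit), which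
-- `linter.dupNamespace` flags; the lakefile turns the linter off tree-wide, restated here for stand-alone checks.
set_option linter.dupNamespace false

namespace Summit.HodgeConjecture.HodgeConjecture.Theorems.CyclicUnitaryPowersLaneDCommutatorClosure

/-- `(⁅A, B⁆).subgroupOf C = ⁅A.subgroupOf C, B.subgroupOf C⁆` when `A, B ≤ C`. [folklore] -/
private theorem subgroupOf_commutator_eq {G : Type*} [Group G] {A B C : Subgroup G} (hA : A ≤ C) (hB : B ≤ C) :
    (⁅A, B⁆).subgroupOf C = ⁅A.subgroupOf C, B.subgroupOf C⁆ := by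
  have hle : ⁅A, B⁆ ≤ C := Subgroup.commutator_le.2 fun a ha b hb => by
    rw [commutatorElement_def]
    exact C.mul_mem (C.mul_mem (C.mul_mem (hA ha) (hB hb)) (C.inv_mem (hA ha))) (C.inv_mem (hB hb))
  apply Subgroup.map_injective C.subtype_injective
  rw [Subgroup.map_commutator, Subgroup.map_subgroupOf_eq_of_le hA, Subgroup.map_subgroupOf_eq_of_le hB,
    Subgroup.map_subgroupOf_eq_of_le hle]

/-- **B2 `UnitaryReflectionDensity` (lane A's algebraic brick) from CT71, GKR' and UD.**  For every finite-index
`Γ' ≤ Γ`, the commutator `g h g⁻¹ h⁻¹` of two `τ`-commuting `B`-isometries lies in the `ℚ`-Zariski closure of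
`⁅Γ', Γ'⁆` (`dim V^τ ≤ 1`, `p ≥ 7` prime, `Γ` generated by the cyclic `τ`-reflections along `R`, one orbit of cyclic
spans, spanning the anti-invariant part).  Assembly: descent to `Γ ⊗ ℂ`; places `E_i = H(ζ^{i+1})`, `i < (p−1)/2`;
low dimension ⇒ trivial commutator; lane D's `⊕ SL(E_i) ⊆ ((block image of Γ ⊗ ℂ)^Zar)°` ⊆ `(block image of
Γ' ⊗ ℂ)^Zar`; commutators of closure points + perfectness of `⊕ SL(E_i)(ℂ)` ⇒ `⊕ SL(E_i) ⊆ (⁅·,·⁆)^Zar`; the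
eigenblock section carries this to `(⁅Γ', Γ'⁆ ⊗ ℂ)^Zar`. [cite: CarlsonToledo1999, §7 Theorem 7.1 (p. 16)]
[cite: Katz1990ESDE, §1.8 Prop. 1.8.2] [cite: Borel1991, I.2.4] [cite: Artin1988, Chap. IV Thm 4.7] -/
theorem unitaryReflectionDensity_of_facts : Literature.AlgebraicGeometry.HodgeTheory.carlsonToledo1999_unitaryReflection_zariskiDense → Literature.AlgebraicGeometry.HodgeTheory.Katz1990_goursatKolchinRibet_specialLinear' → Literature.AlgebraicGeometry.HodgeTheory.specialLinear_subset_glIdentityComponent_of_unitary_commutators → open Literature.AlgebraicGeometry.Motives Literature.AlgebraicGeometry.HodgeTheory Literature.AlgebraicGeometry.HodgeTheory.BettiUniverse CategoryTheory.Limits in ∀ (V : Type) [AddCommGroup V] [Module ℚ V] [Module.Finite ℚ V] (B : LinearMap.BilinForm ℚ V) (τ : V ≃ₗ[ℚ] V) (p : ℕ) (R : Set V) (Γ : Subgroup (V ≃ₗ[ℚ] V)), p.Prime → 7 ≤ p → B.IsSymm → B.Nondegenerate → τ ^ p = 1 → (∀ x y, B (τ x) (τ y) = B x y) → Module.finrank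 ℚ ↥(Module.End.eigenspace (τ : V →ₗ[ℚ] V) 1) ≤ 1 → (∀ δ ∈ R, δ ≠ 0 ∧ (∑ i ∈ Finset.range p, (τ ^ i) δ) = 0 ∧ ∀ x ∈ Submodule.span ℚ (Set.range fun i : ℕ => (τ ^ i) δ), (∀ y ∈ Submodule.span ℚ (Set.range fun i : ℕ => (τ ^ i) δ), B x y = 0) → x = 0) → (∀ δ ∈ R, ∃ r ∈ Γ, ((∀ x ∈ Submodule.span ℚ (Set.range fun i : ℕ => (τ ^ i) δ), r x = τ x) ∧ (∀ x, (∀ y ∈ Submodule.span ℚ (Set.range fun i : ℕ => (τ ^ i) δ), B x y = 0) → r x = x))) → (Γ ≤ Subgroup.closure {r : V ≃ₗ[ℚ] V | ∃ δ ∈ R, ((∀ x ∈ Submodule.span ℚ (Set.range fun i : ℕ => (τ ^ i) δ), r x = τ x) ∧ (∀ x, (∀ y ∈ Submodule.span ℚ (Set.range fun i : ℕ => (τ ^ i) δ), B x y = 0) → r x = x))}) → (∀ δ ∈ R, ∀ δ' ∈ R, ∃ γ ∈ Γ, γ δ' ∈ Submodule.span ℚ (Set.range fun i : ℕ => (τ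 ^ i) δ)) → (∀ x, (∑ i ∈ Finset.range p, (τ ^ i) x) = 0 → x ∈ Submodule.span ℚ {y | ∃ δ ∈ R, ∃ i : ℕ, y = (τ ^ i) δ}) → ∀ Γ' : Subgroup (V ≃ₗ[ℚ] V), Γ' ≤ Γ → (Γ'.subgroupOf Γ).FiniteIndex → ∀ g h : V ≃ₗ[ℚ] V, (∀ x, g (τ x) = τ (g x)) → (∀ x y, B (g x) (g y) = B x y) → (∀ x, h (τ x) = τ (h x)) → (∀ x y, B (h x) (h y) = B x y) → g * h * g⁻¹ * h⁻¹ ∈ glZariskiClosure ⁅Γ', Γ'⁆ := by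
  intro hCT hK hU V _ _ _ B τ p R Γ hp h7 hBs hBn hτp hτB hfix hP1 hP2 hP3 hP4 hP5 Γ' hΓ' hfi g h hgτ hgB hhτ hhB
  have hp0 : 0 < p := hp.pos
  -- (0) the generators, hence Γ, commute with τ and preserve B  [6a: cyclicReflection_comm / _isometry,
  --     comm_and_isometry_of_mem_closure]
  have hpow : ∀ n : ℕ, ((τ : V →ₗ[ℚ] V)) ^ n = ((τ ^ n : V ≃ₗ[ℚ] V) : V →ₗ[ℚ] V) := by
    intro n
    induction n with
    | zero => rw [pow_zero, pow_zero, LinearEquiv.coe_toLinearMap_one]; rfl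
    | succ n ih => rw [pow_succ, pow_succ, LinearEquiv.coe_toLinearMap_mul, ih]
  have hτp' : ((τ : V →ₗ[ℚ] V)) ^ p = 1 := by
    rw [hpow, hτp, LinearEquiv.coe_toLinearMap_one]; rfl
  -- `(↑τ ^ i) δ = (τ ^ i) δ` as functions, to transport the clauses of D to linear maps
  have hpowapp : ∀ (i : ℕ) (x : V), (((τ : V →ₗ[ℚ] V)) ^ i) x = (τ ^ i) x := fun i x => by
    rw [hpow]; rfl
  have hgen : ∀ s ∈ {r : V ≃ₗ[ℚ] V | ∃ δ ∈ R, ((∀ x ∈ Submodule.span ℚ (Set.range fun i : ℕ => (τ ^ i) δ), r x = τ x) ∧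
      (∀ x, (∀ y ∈ Submodule.span ℚ (Set.range fun i : ℕ => (τ ^ i) δ), B x y = 0) → r x = x))},
      (∀ x, s (τ x) = τ (s x)) ∧ ∀ x y, B (s x) (s y) = B x y := by
    rintro s ⟨δ, hδ, hs1, hs2⟩
    have hnd := (hP1 δ hδ).2.2
    have hs1' : ∀ x ∈ Submodule.span ℚ (Set.range fun i : ℕ => ((τ : V →ₗ[ℚ] V) ^ i) δ),
        (s : V →ₗ[ℚ] V) x = (τ : V →ₗ[ℚ] V) x := by
      simpa only [hpowapp, LinearEquiv.coe_coe] using hs1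
    have hs2' : ∀ x, (∀ y ∈ Submodule.span ℚ (Set.range fun i : ℕ => ((τ : V →ₗ[ℚ] V) ^ i) δ), B x y = 0) →
        (s : V →ₗ[ℚ] V) x = x := by
      simpa only [hpowapp, LinearEquiv.coe_coe] using hs2
    have hnd' : ∀ x ∈ Submodule.span ℚ (Set.range fun i : ℕ => ((τ : V →ₗ[ℚ] V) ^ i) δ),
        (∀ y ∈ Submodule.span ℚ (Set.range fun i : ℕ => ((τ : V →ₗ[ℚ] V) ^ i) δ), B x y = 0) → x = 0 := by
      simpa only [hpowapp] using hnd
    refine ⟨fun x => ?_, fun x y => ?_⟩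
    · exact cyclicReflection_comm (r := (s : V →ₗ[ℚ] V)) hBs hp0 hτp' hτB hnd' hs1' hs2' x
    · exact cyclicReflection_isometry (r := (s : V →ₗ[ℚ] V)) hBs hτB hnd' hs1' hs2' x y
  have hΓτB : ∀ γ ∈ Γ, (∀ x, γ (τ x) = τ (γ x)) ∧ ∀ x y, B (γ x) (γ y) = B x y :=
    fun γ hγ => comm_and_isometry_of_mem_closure B τ hgen (hP3 hγ)
  -- (1) a primitive p-th root of unity
  have hζ := Complex.isPrimitiveRoot_exp p hp.ne_zero
  set ζ : ℂ := Complex.exp (2 * Real.pi * Complex.I / p) with hζdef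
  -- (2) descent to ℚ: it suffices to put the complexified commutator in the ℂ-closure of ⁅Γ', Γ'⁆ ⊗ ℂ
  refine mem_glZariskiClosure_of_baseChange (K := ℚ) (L := ℂ) ?_
  rw [Subgroup.map_commutator]
  set Γc : Subgroup (ℂ ⊗[ℚ] V ≃ₗ[ℂ] ℂ ⊗[ℚ] V) := Γ.map (glBaseChangeHom ℚ ℂ V) with hΓc
  -- (3) the places E_i = H(ζ^(i+1)), i < (p-1)/2, stabilised by Γ ⊗ ℂ; H := image of Γ ⊗ ℂ in Π GL(E_i)
  set k : ℕ := (p - 1) / 2 with hk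
  let E : Fin k → Submodule ℂ (ℂ ⊗[ℚ] V) :=
    fun i => Module.End.eigenspace ((τ : V →ₗ[ℚ] V).baseChange ℂ) (ζ ^ ((i : ℕ) + 1))
  have hstabE : ∀ i, Γc ≤ submoduleStabilizer (E i) := fun i =>
    map_glBaseChangeHom_le_submoduleStabilizer_eigenspace (fun γ hγ => (hΓτB γ hγ).1) _
  let ρ : Γc →* Π i, (E i ≃ₗ[ℂ] E i) := piRestrictHom E Γc hstabE
  let ψ : Γc →* ((Π i, E i) ≃ₗ[ℂ] (Π i, E i)) := (blockDiagHom fun i => ↥(E i)).comp ρ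
  set H : Subgroup (Π i, (E i ≃ₗ[ℂ] E i)) := (⊤ : Subgroup Γc).map ρ with hH
  -- (4) dimensions: if some E_i has dimension ≤ 1 the commutator is trivial; assume all ≥ 2 below
  by_cases hdim : ∀ i : Fin k, 2 ≤ finrank ℂ (E i)
  swap
  · -- S2 (low dimension): some `H(ζ^(i₀+1))` has dimension ≤ 1; then ALL `H(ζ^a)`, `a ≠ 0`, do (Galois /
    --   traces: `CyclicEigenspaceDimensions`, prover-A) and `dim H(1) ≤ 1` (clause hfix), so `g` and `h` commute
    --   and the commutator is trivial [`commutator_eq_one_of_finrank_eigenspace_le_one`]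
    simp only [not_forall, not_le] at hdim
    obtain ⟨i₀, hi₀⟩ := hdim
    have hsmall : finrank ℂ (Module.End.eigenspace ((τ : V →ₗ[ℚ] V).baseChange ℂ) (ζ ^ ((i₀ : ℕ) + 1))) ≤ 1 := by
      have : finrank ℂ (E i₀) < 2 := hi₀
      exact Nat.le_of_lt_succ this
    have h1 : g * h * g⁻¹ * h⁻¹ = 1 :=
      commutator_eq_one_of_finrank_eigenspace_le_one hp hτp' hζ hfix (show 1 ≤ (i₀ : ℕ) + 1 by omega)
        (by have := i₀.2; omega) hsmall hgτ hhτ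
    rw [h1, map_one]
    exact one_mem_glZariskiClosure _
  -- (4b) transported clauses, indices, non-emptiness of R, and the per-place reflection data
  have hP1' : ∀ δ ∈ R, δ ≠ 0 ∧ (∑ i ∈ Finset.range p, (((τ : V →ₗ[ℚ] V)) ^ i) δ) = 0 ∧
      ∀ x ∈ Submodule.span ℚ (Set.range fun i : ℕ => (((τ : V →ₗ[ℚ] V)) ^ i) δ),
        (∀ y ∈ Submodule.span ℚ (Set.range fun i : ℕ => (((τ : V →ₗ[ℚ] V)) ^ i) δ), B x y = 0) → x = 0 := by
    intro δ hδ
    simpa only [hpowapp] using hP1 δ hδ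
  have hik : ∀ i : Fin k, 1 ≤ (i : ℕ) + 1 ∧ (i : ℕ) + 1 < p := fun i => ⟨by omega, by have := i.2; omega⟩
  -- (5) Goursat–Kolchin–Ribet on the half system of blocks [`CyclicUnitaryPowersLaneDKatz`, prover-Ax's per-place
  --     Carlson–Toledo data + twist dichotomies]: `⊕ SL(E_i) ⊆ glIdentityComponent (H.map blockDiagHom)`
  have hKatz := CyclicUnitaryPowersLaneDKatz.blockDiag_mem_glIdentityComponent hCT hK hU V B τ p R Γ hp h7 hBs hBn
    hτp hτB hP1 hP2 hP3 hP4 hP5 hΓτB hζ k hk hstabE hdim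
  have hodd : p % 2 = 1 := Nat.odd_iff.mp (hp.odd_of_ne_two (by omega))
  have hΓfix : ∀ γ ∈ Γ, ∀ v, (τ : V →ₗ[ℚ] V) v = v → γ v = v := by
    intro γ hγ v hv
    refine apply_eq_self_of_mem_closure (fun s hs => ?_) (hP3 hγ)
    obtain ⟨δ, hδ, hs1, hs2⟩ := hs
    have hs2' : ∀ x, (∀ y ∈ Submodule.span ℚ (Set.range fun i : ℕ => ((τ : V →ₗ[ℚ] V) ^ i) δ), B x y = 0) →
        (s : V →ₗ[ℚ] V) x = x := by
      simpa only [hpowapp, LinearEquiv.coe_coe] using hs2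
    exact cyclicReflection_apply_of_apply_eq_self (r := (s : V →ₗ[ℚ] V)) hp0 hτB (hP1' δ hδ).2.1 hs2' hv
  obtain ⟨b, c, P, u, hPsec, hu, hPc⟩ := exists_cyclicEigenblockSection_pointwise hBs hBn hp0 hτp' hτB hζ
    (fun i : Fin k => (i : ℕ) + 1) (fun i => hik i) (fun i j hij => Fin.ext (by simpa using hij))
    (fun i j => by have := i.2; have := j.2; omega)
    (fun m hm1 hmp => by
      by_cases hmk : m ≤ k
      · exact ⟨⟨m - 1, by omega⟩, Or.inl (show m - 1 + 1 = m by omega)⟩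
      · exact ⟨⟨p - m - 1, by omega⟩, Or.inr (show p - m - 1 + 1 + m = p by omega)⟩)
    E (fun _ => rfl) (fun γ hγ => (hΓτB γ hγ).1) (fun γ hγ => (hΓτB γ hγ).2) hΓfix hstabE hfix hgτ hgB hhτ hhB
  -- (6) the image of Γ' ⊗ ℂ: finite index in Γ ⊗ ℂ; its commutator subgroup lies in Γ ⊗ ℂ
  set Γ'c : Subgroup (ℂ ⊗[ℚ] V ≃ₗ[ℂ] ℂ ⊗[ℚ] V) := Γ'.map (glBaseChangeHom ℚ ℂ V) with hΓ'c
  have hΓ'cle : Γ'c ≤ Γc := Subgroup.map_mono hΓ'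
  have hfic : (Γ'c.subgroupOf Γc).FiniteIndex := finiteIndex_map_glBaseChangeHom hfi
  -- block images: Λ' := ψ(Γ' ⊗ ℂ) has finite index in ψ(Γ ⊗ ℂ) = H.map blockDiagHom
  set Λ' : Subgroup ((Π i, E i) ≃ₗ[ℂ] (Π i, E i)) := (Γ'c.subgroupOf Γc).map ψ with hΛ'
  have hΛ'fi : (Λ'.subgroupOf ((⊤ : Subgroup Γc).map ψ)).FiniteIndex := by
    refine finiteIndex_map_subgroupOf ψ ?_
    refine ⟨?_⟩
    rw [Subgroup.subgroupOf, Subgroup.index_comap_of_surjective _ (Subgroup.topEquiv (G := Γc)).surjective]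
    exact hfic.index_ne_zero
  -- Katz's conclusion, with H.map blockDiagHom = ⊤.map ψ, weakened to the closure of the finite-index Λ'
  have hHψ : H.map (blockDiagHom fun i => ↥(E i)) = (⊤ : Subgroup Γc).map ψ := by
    rw [hH, Subgroup.map_map]
  have hSL : ∀ v : Π i, (E i ≃ₗ[ℂ] E i), (∀ i, LinearEquiv.det (v i) = 1) →
      blockDiagHom (fun i => ↥(E i)) v ∈ glZariskiClosure Λ' := by
    intro v hv
    have hv' := hKatz v hv
    rw [hHψ] at hv'
    exact glIdentityComponent_subset_of_finiteIndex (Subgroup.map_mono le_top) hΛ'fi hv'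
  -- (7) commutators of closure points lie in the closure of the commutator group (Borel I.2.4), and
  --     `⊕ SL(E_i)(ℂ)` is perfect (Artin IV 4.7): every determinant-one block tuple lies in (⁅Λ', Λ'⁆)^Zar
  have hcomm : ∀ v w : Π i, (E i ≃ₗ[ℂ] E i), (∀ i, LinearEquiv.det (v i) = 1) →
      (∀ i, LinearEquiv.det (w i) = 1) →
      v * w * v⁻¹ * w⁻¹ ∈ (glZariskiClosureSubgroup ⁅Λ', Λ'⁆).comap (blockDiagHom fun i => ↥(E i)) := by
    intro v w hv hw
    rw [Subgroup.mem_comap, map_mul, map_mul, map_mul, map_inv, map_inv, mem_glZariskiClosureSubgroup_iff]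
    exact commutator_mem_glZariskiClosure_commutator (hSL v hv) (hSL w hw)
  have hbdu : blockDiagHom (fun i => ↥(E i)) u ∈ glZariskiClosure ⁅Λ', Λ'⁆ := by
    have hmem := Literature.LinearAlgebra.Matrix.pi_mem_of_det_eq_one_of_forall_commutator_mem _ hcomm hu
    rw [Subgroup.mem_comap, mem_glZariskiClosureSubgroup_iff] at hmem
    exact hmem
  -- (8) ⁅Λ', Λ'⁆ is the block image of ⁅Γ' ⊗ ℂ, Γ' ⊗ ℂ⁆ ≤ Γ ⊗ ℂ
  have hΛeq : ((⁅Γ'c, Γ'c⁆).subgroupOf Γc).map ψ = ⁅Λ', Λ'⁆ := by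
    rw [subgroupOf_commutator_eq hΓ'cle hΓ'cle, Subgroup.map_commutator]
  rw [← hΛeq] at hbdu
  -- (9) transport along the eigenblock section: the commutator ⊗ ℂ lies in (⁅Γ' ⊗ ℂ, Γ' ⊗ ℂ⁆)^Zar
  refine mem_glZariskiClosure_of_evalAtInvDet_of_forall_exists b c P (Θ := ⁅Γ'c, Γ'c⁆) ?_ hbdu hPc
  rintro _ ⟨θ, hθ, rfl⟩
  exact ⟨θ, Subgroup.mem_subgroupOf.1 hθ, hPsec θ⟩


/-- **B2 from the single cited fact CT71** (Carlson–Toledo 1999, Thm 7.1): GKR' and UD are theorems of the tree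
(`Katz1990_goursatKolchinRibet_specialLinear'_holds`, `specialLinear_subset_glIdentityComponent_of_unitary_commutators_holds`).
[cite: CarlsonToledo1999, §7 Theorem 7.1 (p. 16)] [cite: Katz1990ESDE, §1.8 Prop. 1.8.2] -/
theorem unitaryReflectionDensity_of_CT71 : Literature.AlgebraicGeometry.HodgeTheory.carlsonToledo1999_unitaryReflection_zariskiDense → open Literature.AlgebraicGeometry.Motives Literature.AlgebraicGeometry.HodgeTheory Literature.AlgebraicGeometry.HodgeTheory.BettiUniverse CategoryTheory.Limits in ∀ (V : Type) [AddCommGroup V] [Module ℚ V] [Module.Finite ℚ V] (B : LinearMap.BilinForm ℚ V) (τ : V ≃ₗ[ℚ] V) (p : ℕ) (R : Set V) (Γ : Subgroup (V ≃ₗ[ℚ] V)), p.Prime → 7 ≤ p → B.IsSymm → B.Nondegenerate → τ ^ p = 1 → (∀ x y, B (τ x) (τ y) = B x y) → Module.finrank ℚ ↥(Module.End.eigenspace (τ : V →ₗ[ℚ] V) 1) ≤ 1 → (∀ δ ∈ R, δ ≠ 0 ∧ (∑ i ∈ Finset.range p, (τ ^ i) δ) = 0 ∧ ∀ x ∈ Submodule.span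 ℚ (Set.range fun i : ℕ => (τ ^ i) δ), (∀ y ∈ Submodule.span ℚ (Set.range fun i : ℕ => (τ ^ i) δ), B x y = 0) → x = 0) → (∀ δ ∈ R, ∃ r ∈ Γ, ((∀ x ∈ Submodule.span ℚ (Set.range fun i : ℕ => (τ ^ i) δ), r x = τ x) ∧ (∀ x, (∀ y ∈ Submodule.span ℚ (Set.range fun i : ℕ => (τ ^ i) δ), B x y = 0) → r x = x))) → (Γ ≤ Subgroup.closure {r : V ≃ₗ[ℚ] V | ∃ δ ∈ R, ((∀ x ∈ Submodule.span ℚ (Set.range fun i : ℕ => (τ ^ i) δ), r x = τ x) ∧ (∀ x, (∀ y ∈ Submodule.span ℚ (Set.range fun i : ℕ => (τ ^ i) δ), B x y = 0) → r x = x))}) → (∀ δ ∈ R, ∀ δ' ∈ R, ∃ γ ∈ Γ, γ δ' ∈ Submodule.span ℚ (Set.range fun i : ℕ => (τ ^ i) δ)) → (∀ x, (∑ i ∈ Finset.range p, (τ ^ i) x) = 0 → x ∈ Submodule.span ℚ {y | ∃ δ ∈ R, ∃ i : ℕ, y = (τ ^ i) δ}) → ∀ Γ' : Subgroup (V ≃ₗ[ℚ]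 V), Γ' ≤ Γ → (Γ'.subgroupOf Γ).FiniteIndex → ∀ g h : V ≃ₗ[ℚ] V, (∀ x, g (τ x) = τ (g x)) → (∀ x y, B (g x) (g y) = B x y) → (∀ x, h (τ x) = τ (h x)) → (∀ x y, B (h x) (h y) = B x y) → g * h * g⁻¹ * h⁻¹ ∈ glZariskiClosure ⁅Γ', Γ'⁆ :=
  fun hCT => unitaryReflectionDensity_of_facts hCT Katz1990_goursatKolchinRibet_specialLinear'_holds
    specialLinear_subset_glIdentityComponent_of_unitary_commutators_holds

end Summit.HodgeConjecture.HodgeConjecture.Theorems.CyclicUnitaryPowersLaneDCommutatorClosure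

end
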